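import Literature.Probability.Percolation.DecisionTreeWeightedMeasure
import Summits.CriticalPhenomena.PercolationContinuityZ3.Theorems.PercNearOneGluingNoHeavyQuantThreeClusterSwapReduction
import Summits.CriticalPhenomena.PercolationContinuityZ3.Theorems.PercNearOneGluingNoHeavyQuantPerClassCounting
import HarnessLib

/-!
# The product row F1 reduces to a counting inequality on minors ("per-class counting")

builds on p205010 (kernel theorem, internal audit signed; external expert review pending)

Support file (`--supports stmt-CriticalPhenomena-4575`), seat `prim-quant-p1` (gen 41); memo
`run/shared/lean/prim/quant/prim-quant-p1-g41/FOR-LEAD-Z32-PCC.md` §1–§2.  No definitions, no named facts, no sorries;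
standard axioms.

By `PerClassCounting.Pr2W_le_mul_PrW_of_cubeCount` (companion file), a two-configuration bound holds for every
weight vector as soon as it holds as a COUNT in every class `I ⊆ U` of edges (`F = U ∖ I` free, first configuration
`I ∪ (F ∖ T)`, second `I ∪ T`, `T ⊆ F`; i.e. on the minor "contract `I`, delete the rest" with complementary
configurations).  For the product row of the three-port programme (p1 g39/g40:
`P(abc)·P(a|b|c) ≤ C·[P(ab|c)+P(ac|b)]`; `C = 3` closes the three-port case of `Z(3,2)` via ✓ p560550
`ThreePort.le_one_reached_le_of_productRow3`):
* `productRow_of_classCount_PrW`, `productRow_of_classCount` — COEFFICIENTWISE F1: if for all `I ⊆ U`,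
  `#{T ⊆ F : I ∪ T ∈ abc, I ∪ (F∖T) ∈ a|b|c} ≤ m · #{T ⊆ F : I ∪ T ∈ ab|c ∪ ac|b}`   ("TN ≤ m·E"), then
  `P(abc)·P(a|b|c) ≤ m·(P(ab|c)+P(ac|b))` for every weight vector (finitary form / `prodBernoulli` form);
* `productRow_of_classCount_sealed` — the same with g40's doubly-sealed-failure set `B` counted on the left
  ("B ≤ m·E") and constant `1 + m`, through ✓ p577001 `ThreeClusterSwap.productRow_of_Pr2W_bound`;
* `hRow_of_classCount_PrW`, `hRow_of_classCount` — the linear three-cluster row `H_{1/m}` of p1 g38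
  (`P(a↔b ∨ a↔c)·P(b↮c) ≤ m·P(E_a)`) from the count "Q ≤ m·E" (`Q = #{a attached in X, b|c in X̄}`; memo §2bis,
  conjecturally `m = 3/2`, verified on every graph with ≤ 7 vertices).
The counts are the conjectures PCC of the memo §2 (exhaustively verified there with `m = 3/2`, resp. `m = 1`, on every
graph with at most 7 vertices; equality for "TN ≤ (3/2)E" exactly on the hub family); this file turns any future proof of
them — combinatorial, or certified-computational on a fixed vertex type — into the weighted row inside the kernel.
-/

noncomputable section

namespace Summit.CriticalPhenomena.PercolationContinuityZ3.Theorems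

open Finset Literature.Probability.Percolation Literature.Probability.Percolation.DecisionTree
open scoped Classical

/-! ### The product row F1 reduces to counting on minors -/

namespace ThreeClusterSwap

open PerClassCounting

variable {V : Type*} [Fintype V] [DecidableEq V]

/-- **Coefficientwise product row (finitary form).**  If for every class `I ⊆ U` of edges, `F = U ∖ I`,
the number of `T ⊆ F` with `I ∪ T ∈ abc` and `I ∪ (F ∖ T) ∈ a|b|c` is at most `m` times the number of `T ⊆ F`
with `I ∪ T ∈ ab|c ∪ ac|b` (the count "TN ≤ m·E" of the memo on the minor `contract I / delete the rest`), then
`PrW{abc}·PrW{a|b|c} ≤ m·(PrW{ab|c} + PrW{ac|b})` for every weight vector. [this work] -/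
theorem productRow_of_classCount_PrW (p : Sym2 V → ℝ) (hp0 : ∀ e, 0 ≤ p e) (hp1 : ∀ e, p e ≤ 1)
    (a b c : V) {m : ℝ} (hm : 0 ≤ m)
    (h : ∀ I U : Finset (Sym2 V), I ⊆ U →
      ((((U \ I).powerset).filter fun T =>
          (¬ (openGraph (↑(I ∪ ((U \ I) \ T)) : Set (Sym2 V))).Reachable a b ∧
            ¬ (openGraph (↑(I ∪ ((U \ I) \ T)) : Set (Sym2 V))).Reachable a c ∧
            ¬ (openGraph (↑(I ∪ ((U \ I) \ T)) : Set (Sym2 V))).Reachable b c) ∧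
          ((openGraph (↑(I ∪ T) : Set (Sym2 V))).Reachable a b ∧
            (openGraph (↑(I ∪ T) : Set (Sym2 V))).Reachable a c)).card : ℝ) ≤
        m * ((((U \ I).powerset).filter fun T =>
          ((openGraph (↑(I ∪ T) : Set (Sym2 V))).Reachable a b ∧
              ¬ (openGraph (↑(I ∪ T) : Set (Sym2 V))).Reachable a c) ∨
            ((openGraph (↑(I ∪ T) : Set (Sym2 V))).Reachable a c ∧
              ¬ (openGraph (↑(I ∪ T) : Set (Sym2 V))).Reachable a b)).card : ℝ)) :
    PrW Finset.univ p {S : Finset (Sym2 V) | (openGraph (↑S : Set (Sym2 V))).Reachable a b ∧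
        (openGraph (↑S : Set (Sym2 V))).Reachable a c} *
      PrW Finset.univ p {S : Finset (Sym2 V) | ¬ (openGraph (↑S : Set (Sym2 V))).Reachable a b ∧
        ¬ (openGraph (↑S : Set (Sym2 V))).Reachable a c ∧ ¬ (openGraph (↑S : Set (Sym2 V))).Reachable b c} ≤
    m * (PrW Finset.univ p {S : Finset (Sym2 V) | (openGraph (↑S : Set (Sym2 V))).Reachable a b ∧
          ¬ (openGraph (↑S : Set (Sym2 V))).Reachable a c} +
        PrW Finset.univ p {S : Finset (Sym2 V) | (openGraph (↑S : Set (Sym2 V))).Reachable a c ∧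
          ¬ (openGraph (↑S : Set (Sym2 V))).Reachable a b}) := by
  set D : Finset (Sym2 V) := Finset.univ with hD
  let R : Finset (Sym2 V) → V → V → Prop := fun S x y => (openGraph (↑S : Set (Sym2 V))).Reachable x y
  let abc : Set (Finset (Sym2 V)) := {S | R S a b ∧ R S a c}
  let sep : Set (Finset (Sym2 V)) := {S | ¬ R S a b ∧ ¬ R S a c ∧ ¬ R S b c}
  let abEv : Set (Finset (Sym2 V)) := {S | R S a b ∧ ¬ R S a c}
  let acEv : Set (Finset (Sym2 V)) := {S | R S a c ∧ ¬ R S a b}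
  change PrW D p abc * PrW D p sep ≤ m * (PrW D p abEv + PrW D p acEv)
  have hdisj : Disjoint abEv acEv := by
    rw [Set.disjoint_left]
    intro S hS hS'
    exact hS.2 hS'.1
  rw [← PrW_union D p hdisj, mul_comm (PrW D p abc), ← Pr2W_prod]
  refine Pr2W_le_mul_PrW_of_cubeCount D hp0 hp1 (sep ×ˢ abc) (abEv ∪ acEv) hm fun I U hIU _ => ?_
  refine le_trans (Nat.cast_le.2 (Finset.card_le_card fun T hT => ?_))
    ((h I U hIU).trans (mul_le_mul_of_nonneg_left (Nat.cast_le.2 (Finset.card_le_card fun T hT => ?_)) hm))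
  · rw [Finset.mem_filter] at hT ⊢
    exact ⟨hT.1, hT.2⟩
  · rw [Finset.mem_filter] at hT ⊢
    exact ⟨hT.1, hT.2⟩

/-- **Coefficientwise product row for `prodBernoulli w`** (every finite weighted graph): under the per-class
count "TN ≤ m·E" of `productRow_of_classCount_PrW`,
`P(a↔b ∧ a↔c)·P(a↮b ∧ a↮c ∧ b↮c) ≤ m·(P(a↔b ∧ a↮c) + P(a↔c ∧ a↮b))`.  With `m ≤ 3` this is the per-apex
hypothesis shape of ✓ p560550 `ThreePort.le_one_reached_le_of_productRow3` (memo: the count holds with `m = 3/2`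
on every graph with at most 7 vertices). [this work] -/
theorem productRow_of_classCount (w : Sym2 V → unitInterval) (a b c : V) {m : ℝ} (hm : 0 ≤ m)
    (h : ∀ I U : Finset (Sym2 V), I ⊆ U →
      ((((U \ I).powerset).filter fun T =>
          (¬ (openGraph (↑(I ∪ ((U \ I) \ T)) : Set (Sym2 V))).Reachable a b ∧
            ¬ (openGraph (↑(I ∪ ((U \ I) \ T)) : Set (Sym2 V))).Reachable a c ∧
            ¬ (openGraph (↑(I ∪ ((U \ I) \ T)) : Set (Sym2 V))).Reachable b c) ∧
          ((openGraph (↑(I ∪ T) : Set (Sym2 V))).Reachable a b ∧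
            (openGraph (↑(I ∪ T) : Set (Sym2 V))).Reachable a c)).card : ℝ) ≤
        m * ((((U \ I).powerset).filter fun T =>
          ((openGraph (↑(I ∪ T) : Set (Sym2 V))).Reachable a b ∧
              ¬ (openGraph (↑(I ∪ T) : Set (Sym2 V))).Reachable a c) ∨
            ((openGraph (↑(I ∪ T) : Set (Sym2 V))).Reachable a c ∧
              ¬ (openGraph (↑(I ∪ T) : Set (Sym2 V))).Reachable a b)).card : ℝ)) :
    (Literature.Probability.LatticeModels.prodBernoulli w).real (openConn a b ∩ openConn a c) *
      (Literature.Probability.LatticeModels.prodBernoulli w).real ((openConn a b)ᶜ ∩ (openConn a c)ᶜ ∩ (openConn b c)ᶜ) ≤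
    m * ((Literature.Probability.LatticeModels.prodBernoulli w).real (openConn a b ∩ (openConn a c)ᶜ) +
      (Literature.Probability.LatticeModels.prodBernoulli w).real (openConn a c ∩ (openConn a b)ᶜ)) := by
  set p : Sym2 V → ℝ := fun e => (w e : ℝ) with hp
  have hp0 : ∀ e, 0 ≤ p e := fun e => (w e).2.1
  have hp1 : ∀ e, p e ≤ 1 := fun e => (w e).2.2
  have hdet : ∀ C : Set (BondConfig V), DeterminedBy C (↑(Finset.univ : Finset (Sym2 V)) : Set (Sym2 V)) := by
    intro C
    rw [determinedBy_iff]
    intro ω ω' h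
    rw [Finset.coe_univ, Set.inter_univ, Set.inter_univ] at h
    rw [h]
  have eABC : (Literature.Probability.LatticeModels.prodBernoulli w).real (openConn a b ∩ openConn a c) =
      PrW Finset.univ p {S : Finset (Sym2 V) | (openGraph (↑S : Set (Sym2 V))).Reachable a b ∧
        (openGraph (↑S : Set (Sym2 V))).Reachable a c} :=
    prodBernoulli_real_eq_PrW w (hdet _) fun S _ => Iff.rfl
  have eTri : (Literature.Probability.LatticeModels.prodBernoulli w).real
        ((openConn a b)ᶜ ∩ (openConn a c)ᶜ ∩ (openConn b c)ᶜ) =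
      PrW Finset.univ p {S : Finset (Sym2 V) | ¬ (openGraph (↑S : Set (Sym2 V))).Reachable a b ∧
        ¬ (openGraph (↑S : Set (Sym2 V))).Reachable a c ∧ ¬ (openGraph (↑S : Set (Sym2 V))).Reachable b c} :=
    prodBernoulli_real_eq_PrW w (hdet _) fun S _ => by
      simp only [Set.mem_setOf_eq, Set.mem_inter_iff, Set.mem_compl_iff, openConn, and_assoc]
  have eAB : (Literature.Probability.LatticeModels.prodBernoulli w).real (openConn a b ∩ (openConn a c)ᶜ) =
      PrW Finset.univ p {S : Finset (Sym2 V) | (openGraph (↑S : Set (Sym2 V))).Reachable a b ∧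
        ¬ (openGraph (↑S : Set (Sym2 V))).Reachable a c} :=
    prodBernoulli_real_eq_PrW w (hdet _) fun S _ => Iff.rfl
  have eAC : (Literature.Probability.LatticeModels.prodBernoulli w).real (openConn a c ∩ (openConn a b)ᶜ) =
      PrW Finset.univ p {S : Finset (Sym2 V) | (openGraph (↑S : Set (Sym2 V))).Reachable a c ∧
        ¬ (openGraph (↑S : Set (Sym2 V))).Reachable a b} :=
    prodBernoulli_real_eq_PrW w (hdet _) fun S _ => Iff.rfl
  rw [eABC, eTri, eAB, eAC]
  exact productRow_of_classCount_PrW p hp0 hp1 a b c hm h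

/-- **Per-class counting for the doubly-sealed-failure set closes the product row with constant `1 + m`.**
If in every class `I ⊆ U`, `F = U ∖ I`, the number of `T ⊆ F` whose pair `(C₂, C₁) = (I ∪ (F∖T), I ∪ T)` lies in
g40's set `B` (`C₂ ∈ a|b|c`, `C₁ ∈ abc`, both single seals fail) is at most `m` times the number of `T ⊆ F` with
`I ∪ T ∈ ab|c ∪ ac|b` (the count "B ≤ m·E" of the memo; `m = 1` verified on every graph with ≤ 7 vertices), then
`P(abc)·P(a|b|c) ≤ (1+m)·(P(ab|c)+P(ac|b))` on every finite weighted graph — by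
`ThreeClusterSwap.productRow_of_Pr2W_bound` (✓ p577001). [this work] -/
theorem productRow_of_classCount_sealed (w : Sym2 V → unitInterval) (a b c : V) {m : ℝ} (hm : 0 ≤ m)
    (h : ∀ I U : Finset (Sym2 V), I ⊆ U →
      ((((U \ I).powerset).filter fun T =>
          ((¬ (openGraph (↑(I ∪ ((U \ I) \ T)) : Set (Sym2 V))).Reachable a b ∧
              ¬ (openGraph (↑(I ∪ ((U \ I) \ T)) : Set (Sym2 V))).Reachable a c ∧
              ¬ (openGraph (↑(I ∪ ((U \ I) \ T)) : Set (Sym2 V))).Reachable b c) ∧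
            ((openGraph (↑(I ∪ T) : Set (Sym2 V))).Reachable a b ∧
              (openGraph (↑(I ∪ T) : Set (Sym2 V))).Reachable a c) ∧
            ¬ (openGraph ((↑(I ∪ T) : Set (Sym2 V)) \
                {e | ∃ v ∈ {v | (openGraph (↑(I ∪ ((U \ I) \ T)) : Set (Sym2 V))).Reachable c v}, v ∈ e})).Reachable a b ∧
            ¬ (openGraph ((↑(I ∪ T) : Set (Sym2 V)) \
                {e | ∃ v ∈ {v | (openGraph (↑(I ∪ ((U \ I) \ T)) : Set (Sym2 V))).Reachable b v}, v ∈ e})).Reachable a c)).card : ℝ) ≤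
        m * ((((U \ I).powerset).filter fun T =>
          ((openGraph (↑(I ∪ T) : Set (Sym2 V))).Reachable a b ∧
              ¬ (openGraph (↑(I ∪ T) : Set (Sym2 V))).Reachable a c) ∨
            ((openGraph (↑(I ∪ T) : Set (Sym2 V))).Reachable a c ∧
              ¬ (openGraph (↑(I ∪ T) : Set (Sym2 V))).Reachable a b)).card : ℝ)) :
    (Literature.Probability.LatticeModels.prodBernoulli w).real (openConn a b ∩ openConn a c) *
      (Literature.Probability.LatticeModels.prodBernoulli w).real ((openConn a b)ᶜ ∩ (openConn a c)ᶜ ∩ (openConn b c)ᶜ) ≤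
    (1 + m) * ((Literature.Probability.LatticeModels.prodBernoulli w).real (openConn a b ∩ (openConn a c)ᶜ) +
      (Literature.Probability.LatticeModels.prodBernoulli w).real (openConn a c ∩ (openConn a b)ᶜ)) := by
  set p : Sym2 V → ℝ := fun e => (w e : ℝ) with hp
  have hp0 : ∀ e, 0 ≤ p e := fun e => (w e).2.1
  have hp1 : ∀ e, p e ≤ 1 := fun e => (w e).2.2
  refine productRow_of_Pr2W_bound w a b c m ?_
  set D : Finset (Sym2 V) := Finset.univ with hD
  let R : Finset (Sym2 V) → V → V → Prop := fun S x y => (openGraph (↑S : Set (Sym2 V))).Reachable x y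
  let Rav : Finset (Sym2 V) → Finset (Sym2 V) → V → V → Prop := fun S₂ S₁ t u =>
    (openGraph ((↑S₁ : Set (Sym2 V)) \ {e | ∃ v ∈ {v | R S₂ t v}, v ∈ e})).Reachable a u
  let abEv : Set (Finset (Sym2 V)) := {S | R S a b ∧ ¬ R S a c}
  let acEv : Set (Finset (Sym2 V)) := {S | R S a c ∧ ¬ R S a b}
  let B : Set (Finset (Sym2 V) × Finset (Sym2 V)) :=
    {x | (¬ R x.1 a b ∧ ¬ R x.1 a c ∧ ¬ R x.1 b c) ∧ (R x.2 a b ∧ R x.2 a c) ∧ ¬ Rav x.1 x.2 c b ∧ ¬ Rav x.1 x.2 b c}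
  have hdet : ∀ C : Set (BondConfig V), DeterminedBy C (↑(Finset.univ : Finset (Sym2 V)) : Set (Sym2 V)) := by
    intro C
    rw [determinedBy_iff]
    intro ω ω' h'
    rw [Finset.coe_univ, Set.inter_univ, Set.inter_univ] at h'
    rw [h']
  have eAB : (Literature.Probability.LatticeModels.prodBernoulli w).real (openConn a b ∩ (openConn a c)ᶜ) =
      PrW D p abEv := prodBernoulli_real_eq_PrW w (hdet _) fun S _ => Iff.rfl
  have eAC : (Literature.Probability.LatticeModels.prodBernoulli w).real (openConn a c ∩ (openConn a b)ᶜ) =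
      PrW D p acEv := prodBernoulli_real_eq_PrW w (hdet _) fun S _ => Iff.rfl
  have hdisj : Disjoint abEv acEv := by
    rw [Set.disjoint_left]
    intro S hS hS'
    exact hS.2 hS'.1
  change Pr2W D p B ≤ m * ((Literature.Probability.LatticeModels.prodBernoulli w).real (openConn a b ∩ (openConn a c)ᶜ) +
      (Literature.Probability.LatticeModels.prodBernoulli w).real (openConn a c ∩ (openConn a b)ᶜ))
  rw [eAB, eAC, ← PrW_union D p hdisj]
  refine Pr2W_le_mul_PrW_of_cubeCount D hp0 hp1 B (abEv ∪ acEv) hm fun I U hIU _ => ?_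
  refine le_trans (Nat.cast_le.2 (Finset.card_le_card fun T hT => ?_))
    ((h I U hIU).trans (mul_le_mul_of_nonneg_left (Nat.cast_le.2 (Finset.card_le_card fun T hT => ?_)) hm))
  · rw [Finset.mem_filter] at hT ⊢
    exact ⟨hT.1, hT.2⟩
  · rw [Finset.mem_filter] at hT ⊢
    exact ⟨hT.1, hT.2⟩

/-- **Coefficientwise H-row (finitary form).**  If for every class `I ⊆ U`, `F = U ∖ I`, the number of `T ⊆ F` with
`a ↔ b ∨ a ↔ c` in `I ∪ T` and `b ↮ c` in `I ∪ (F ∖ T)` is at most `m` times the number of `T ⊆ F` with `I ∪ T ∈ ab|c ∪ ac|b`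
(the count "Q ≤ m·E" of the memo §2bis; verified with `m = 3/2` on every graph with ≤ 7 vertices), then
`PrW{a↔b ∨ a↔c} · PrW{b↮c} ≤ m·(PrW{ab|c} + PrW{ac|b})` for every weight vector — p1 g38's linear three-cluster row `H_κ`
with `κ = 1/m`. [this work] -/
theorem hRow_of_classCount_PrW (p : Sym2 V → ℝ) (hp0 : ∀ e, 0 ≤ p e) (hp1 : ∀ e, p e ≤ 1)
    (a b c : V) {m : ℝ} (hm : 0 ≤ m)
    (h : ∀ I U : Finset (Sym2 V), I ⊆ U →
      ((((U \ I).powerset).filter fun T =>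
          ¬ (openGraph (↑(I ∪ ((U \ I) \ T)) : Set (Sym2 V))).Reachable b c ∧
          ((openGraph (↑(I ∪ T) : Set (Sym2 V))).Reachable a b ∨
            (openGraph (↑(I ∪ T) : Set (Sym2 V))).Reachable a c)).card : ℝ) ≤
        m * ((((U \ I).powerset).filter fun T =>
          ((openGraph (↑(I ∪ T) : Set (Sym2 V))).Reachable a b ∧
              ¬ (openGraph (↑(I ∪ T) : Set (Sym2 V))).Reachable a c) ∨
            ((openGraph (↑(I ∪ T) : Set (Sym2 V))).Reachable a c ∧
              ¬ (openGraph (↑(I ∪ T) : Set (Sym2 V))).Reachable a b)).card : ℝ)) :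
    PrW Finset.univ p {S : Finset (Sym2 V) | (openGraph (↑S : Set (Sym2 V))).Reachable a b ∨
        (openGraph (↑S : Set (Sym2 V))).Reachable a c} *
      PrW Finset.univ p {S : Finset (Sym2 V) | ¬ (openGraph (↑S : Set (Sym2 V))).Reachable b c} ≤
    m * (PrW Finset.univ p {S : Finset (Sym2 V) | (openGraph (↑S : Set (Sym2 V))).Reachable a b ∧
          ¬ (openGraph (↑S : Set (Sym2 V))).Reachable a c} +
        PrW Finset.univ p {S : Finset (Sym2 V) | (openGraph (↑S : Set (Sym2 V))).Reachable a c ∧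
          ¬ (openGraph (↑S : Set (Sym2 V))).Reachable a b}) := by
  set D : Finset (Sym2 V) := Finset.univ with hD
  let R : Finset (Sym2 V) → V → V → Prop := fun S x y => (openGraph (↑S : Set (Sym2 V))).Reachable x y
  let att : Set (Finset (Sym2 V)) := {S | R S a b ∨ R S a c}
  let sepbc : Set (Finset (Sym2 V)) := {S | ¬ R S b c}
  let abEv : Set (Finset (Sym2 V)) := {S | R S a b ∧ ¬ R S a c}
  let acEv : Set (Finset (Sym2 V)) := {S | R S a c ∧ ¬ R S a b}
  change PrW D p att * PrW D p sepbc ≤ m * (PrW D p abEv + PrW D p acEv)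
  have hdisj : Disjoint abEv acEv := by
    rw [Set.disjoint_left]
    intro S hS hS'
    exact hS.2 hS'.1
  rw [← PrW_union D p hdisj, mul_comm (PrW D p att), ← Pr2W_prod]
  refine Pr2W_le_mul_PrW_of_cubeCount D hp0 hp1 (sepbc ×ˢ att) (abEv ∪ acEv) hm fun I U hIU _ => ?_
  refine le_trans (Nat.cast_le.2 (Finset.card_le_card fun T hT => ?_))
    ((h I U hIU).trans (mul_le_mul_of_nonneg_left (Nat.cast_le.2 (Finset.card_le_card fun T hT => ?_)) hm))
  · rw [Finset.mem_filter] at hT ⊢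
    exact ⟨hT.1, hT.2⟩
  · rw [Finset.mem_filter] at hT ⊢
    exact ⟨hT.1, hT.2⟩

/-- **Coefficientwise H-row for `prodBernoulli w`**: under the count "Q ≤ m·E" of `hRow_of_classCount_PrW`,
`P(a↔b ∨ a↔c)·P(b↮c) ≤ m·(P(a↔b ∧ a↮c) + P(a↔c ∧ a↮b))`, i.e. `H_κ` with `κ = 1/m` on every finite weighted graph
(✓ p560550 / `ThreePort.le_one_reached_le_of_H_quarter` need `κ ≥ 1/4`, up to the off-observer restriction handled there). [this work] -/
theorem hRow_of_classCount (w : Sym2 V → unitInterval) (a b c : V) {m : ℝ} (hm : 0 ≤ m)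
    (h : ∀ I U : Finset (Sym2 V), I ⊆ U →
      ((((U \ I).powerset).filter fun T =>
          ¬ (openGraph (↑(I ∪ ((U \ I) \ T)) : Set (Sym2 V))).Reachable b c ∧
          ((openGraph (↑(I ∪ T) : Set (Sym2 V))).Reachable a b ∨
            (openGraph (↑(I ∪ T) : Set (Sym2 V))).Reachable a c)).card : ℝ) ≤
        m * ((((U \ I).powerset).filter fun T =>
          ((openGraph (↑(I ∪ T) : Set (Sym2 V))).Reachable a b ∧
              ¬ (openGraph (↑(I ∪ T) : Set (Sym2 V))).Reachable a c) ∨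
            ((openGraph (↑(I ∪ T) : Set (Sym2 V))).Reachable a c ∧
              ¬ (openGraph (↑(I ∪ T) : Set (Sym2 V))).Reachable a b)).card : ℝ)) :
    (Literature.Probability.LatticeModels.prodBernoulli w).real (openConn a b ∪ openConn a c) *
      (Literature.Probability.LatticeModels.prodBernoulli w).real (openConn b c)ᶜ ≤
    m * ((Literature.Probability.LatticeModels.prodBernoulli w).real (openConn a b ∩ (openConn a c)ᶜ) +
      (Literature.Probability.LatticeModels.prodBernoulli w).real (openConn a c ∩ (openConn a b)ᶜ)) := by
  set p : Sym2 V → ℝ := fun e => (w e : ℝ) with hp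
  have hp0 : ∀ e, 0 ≤ p e := fun e => (w e).2.1
  have hp1 : ∀ e, p e ≤ 1 := fun e => (w e).2.2
  have hdet : ∀ C : Set (BondConfig V), DeterminedBy C (↑(Finset.univ : Finset (Sym2 V)) : Set (Sym2 V)) := by
    intro C
    rw [determinedBy_iff]
    intro ω ω' h'
    rw [Finset.coe_univ, Set.inter_univ, Set.inter_univ] at h'
    rw [h']
  have eAtt : (Literature.Probability.LatticeModels.prodBernoulli w).real (openConn a b ∪ openConn a c) =
      PrW Finset.univ p {S : Finset (Sym2 V) | (openGraph (↑S : Set (Sym2 V))).Reachable a b ∨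
        (openGraph (↑S : Set (Sym2 V))).Reachable a c} :=
    prodBernoulli_real_eq_PrW w (hdet _) fun S _ => by
      simp only [Set.mem_setOf_eq, Set.mem_union, openConn]
  have eSep : (Literature.Probability.LatticeModels.prodBernoulli w).real (openConn b c)ᶜ =
      PrW Finset.univ p {S : Finset (Sym2 V) | ¬ (openGraph (↑S : Set (Sym2 V))).Reachable b c} :=
    prodBernoulli_real_eq_PrW w (hdet _) fun S _ => by
      simp only [Set.mem_setOf_eq, Set.mem_compl_iff, openConn]
  have eAB : (Literature.Probability.LatticeModels.prodBernoulli w).real (openConn a b ∩ (openConn a c)ᶜ) =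
      PrW Finset.univ p {S : Finset (Sym2 V) | (openGraph (↑S : Set (Sym2 V))).Reachable a b ∧
        ¬ (openGraph (↑S : Set (Sym2 V))).Reachable a c} :=
    prodBernoulli_real_eq_PrW w (hdet _) fun S _ => Iff.rfl
  have eAC : (Literature.Probability.LatticeModels.prodBernoulli w).real (openConn a c ∩ (openConn a b)ᶜ) =
      PrW Finset.univ p {S : Finset (Sym2 V) | (openGraph (↑S : Set (Sym2 V))).Reachable a c ∧
        ¬ (openGraph (↑S : Set (Sym2 V))).Reachable a b} :=
    prodBernoulli_real_eq_PrW w (hdet _) fun S _ => Iff.rfl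
  rw [eAtt, eSep, eAB, eAC]
  exact hRow_of_classCount_PrW p hp0 hp1 a b c hm h

end ThreeClusterSwap

end Summit.CriticalPhenomena.PercolationContinuityZ3.Theorems
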